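import Summits.CriticalPhenomena.CardyFormulaZ2.Theses.CardyIKTransport
import Literature.Probability.LatticeModels.CornerFugacityMeasure
import Literature.Probability.LatticeModels.CellGridSaddlePercolation

/-!
# Line `symmetric-seed-second-order` — crux `CardyIKTransport.CornerLineDescent` (stmt-CriticalPhenomena-10964)
# CHECKED SKELETON (crux-plan, round 1, 2026-08-16)

Five registered stubs `stub_*` (the only `sorry`s of this file), the kernel-checked sorry-free
composition `CornerLineDescent_of_stubs`, and the skeleton theorem `CornerLineDescent_of` (concludes the
crux BY NAME, modulo exactly the stubs).  Companion line card: `Lines/symmetric-seed-second-order.md`.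

THE LINE (idea card `Ideas/symmetric-seed-second-order.md`, triage r1: pass ×3).  Work in the crux's OWN
i.i.d.-bit gauge, abstracted in the plaquette-defect density `p` (`gaugeCrossingProb p`; the crux's `P_IK`
is `p = p_IK = 2√3 − 3`, i.e. corner fugacity `t = p/(1−p) = √3/2`; `p = 0` is bond-`ℤ²` at `½` on the
renewal grid; `cornerLineDescent_iff` certifies the reading by `Iff.rfl`).  The defect bits `κ_f` are
independent Bernoulli(`p`), so along the corner line `b = ½` the NON-MONOTONE product-measure Russo formula
is exact: `d/dp P_p(A) = Σ_f I_f(p)`, `I_f(p) = P_p(A | κ_f = 1) − P_p(A | κ_f = 0) = Cov_p(1_A, κ_f)/(p(1−p))`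
(`influence`; law-local by `Negative.QuadrantFlipLocal.isOddFace_quadFlip_iff`: one defect = the corner
fugacity inverted at ONE face).  The lever: the seed `κ_f − p` is `D₄(f)`-invariant and
(colour-flip ∘ coin-flip)-invariant — exact symmetries of every `M(t,½)` — while the local connection
functional is odd under `ι = (flip ∘ coin-flip) ∘ rot_{π/2}(f)` (Hex lemma, `cellCrossing_duality_holds`),
and the conditional bias of `κ_f` given the colours on a ring of radius `r` around `f` is `O(ρ^{2r})`,
`ρ = 1 − 2p` (`stub_SyndromeBias`, the plaid-parity character computation: the ring reveals only the row-
and column-parities of the enclosed syndromes).  Hence the FOUR-ARM AMPLITUDE of the seed vanishes for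
every bulk face at every `t`, and the per-face influence is second order (six-arm / messenger channel):
summed over the `≍ δ⁻²` faces it is `≤ C p⁻¹ (δ/p)^θ` in units of the wall-persistence length `ξ_p ≍ 1/p`
(`stub_SummedInfluence`, THE load-bearing open stub, = the card's U2 with the boundary layer budgeted in),
and in the dilute regime `p ≤ c δ` it is `≤ C δ^{κ−1}` with `κ > 0` (`stub_DiluteInfluence`: signed
single-dislocation size `x₀ > 1`, the frozen-end face of the same selection rule = annealed Burgers
neutrality).  Russo (`stub_Russo`) integrates these: dyadically in `p` over `[Kδ, p_IK]`
(`uci_of`, proved here) and linearly over `[0, Kδ]` (`regimeOne_of`, proved here); the two windows OVERLAP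
at `p = Kδ` (`endgame_core`, proved here), giving `|P_IK(R,δ) − P_0(R,δ)| → 0` for every conformal
rectangle with NO limit object and no interchange of limits.  The crux's hypothesis (Cardy for `P_IK`)
then transfers to the renewal-grid bond model `p = 0`, and `stub_FreezeToStandard` (annealed renewal-grid
homogenisation + the exact FreezeIdentification; both ends bond-`ℤ²` at `½`) carries it to the standard
embedding — which is the crux.

DISPROOF USED (`Cruxes/CornerLineDescent/Disproof.lean`, cdisprove cycle 1, §A–§H, read 2026-08-16).  §B:
the crux has NO `_false_without_` theorem (its only hypothesis is `CardyIK`); the line USES that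
hypothesis, at the single point `CornerLineDescent_of_stubs` (limit transfer along the vanishing
difference `P_IK − P_0`).  §A `cornerLineDescent_iff_ikBondBridge`: what the stubs deliver in the gauge is
the `o(1)` bridge `P_IK − P_0 → 0` (renewal-grid form of `IKBondBridge`), as §A says any proof must.  §C
`not_blind_transport` / `not_transport_under` (landed `Negative/ModelBlindTransport`): honoured — every stub
is a statement about the explicit lattice measures; no property of limit families is transported.  §D /
`Negative/CornerFaceNoMonotone` (no FKG on colours, no stochastic order in `t`): honoured by construction —
Russo here is the PRODUCT-measure formula on the independent syndrome bits (the XOR-of-defect-fields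
comparison §D says a proof must use), never a monotone coupling; positive association is only ever used in
the coins given the walls (§F's lever).  §G(1)–(4) / `Negative/QuadrantFlipLocal`: the law-locality
`I_f = Cov/(p(1−p))` is exactly `influence`; §G(4)'s warning (selection rule is a BULK statement; the
boundary layer has response exponent 1 and must be budgeted separately) is written into the statement of
`stub_SummedInfluence` (a bound on the sum over ALL faces, bulk + boundary layer + exterior) and its brief.
§H(i): the ideator's First lemma (centred-square `Cov = 0`) is TRUE but content-free; it is NOT a stub here
— replaced, as triage r1-3 asked, by the informative `stub_SyndromeBias`.  No stub is an instance of a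
landed Negative lemma; negatives index (`ledger negatives`, 8 refuted in the summit): none related.

LEAD RESHAPE (line lead `prover-line-stmt-CriticalPhenomena-10964-0`, 2026-08-16, cycle 1): one registered stub
added, `stub_Locality` (`CrossingEventLocalAt`: at mesh `δ > 0` the crude crossing event is determined by finitely
many bits of each of the five factors — the combinatorial half of Margulis–Russo, also the finite-support fact every
influence bound uses), and `stub_Russo` now takes it as its hypothesis (the measure-theoretic half: cylinder
decomposition of the five-fold product, polynomial in `p`, pairing `S ↔ S ∪ {f}`, mean value inequality).  Six stubs
(≤ stubs_max 7); the composition `CornerLineDescent_of_stubs` is unchanged, `CornerLineDescent_of` feeds it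
`stub_Russo stub_Locality`.
-/

noncomputable section

namespace Summit.CriticalPhenomena.CardyFormulaZ2.Cruxes.CornerLineDescent.SymmetricSeedSecondOrder

open scoped BigOperators Topology Classical MeasureTheory ProbabilityTheory ENNReal NNReal
open Filter Set Function MeasureTheory
open Literature.Probability.Percolation (sitePercolation bondPercolation half BondConfig embDomainCrossing rectangle)
open Literature.Probability.LatticeModels
open Literature.Probability.RandomPlanarGeometry

/-! ## §1 The corner-line gauge, abstracted in the defect density `p` -/

/-- The bit space of the crux's explicit gauge: column bits `A`, row bits `B`, plaquette defects
(syndromes) `D`, an unused fair defect field (the `S = univ` specialisation of stmt-5911), saddle coins. [folklore] -/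
abbrev Bits : Type := Set ℤ × (Set ℤ × (Set (Site 2) × (Set (Site 2) × Set (Site 2))))

/-- The corner-line product measure with syndrome density `p` (clamped to `[0,1]`): verbatim the crux's `μ`
with `2√3 − 3` replaced by `p`.  `p = 2√3−3` is the isotropic Izergin–Korepin point (`t = √3/2`), `p = 0`
the renewal-grid bond model, `p = ½` the i.i.d. colouring. [folklore] -/
def gaugeMeasure (p : ℝ) : Measure Bits :=
  (sitePercolation ℤ half).prod ((sitePercolation ℤ half).prod
    ((sitePercolation (Site 2) (Set.projIcc (0:ℝ) 1 zero_le_one p)).prod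
      ((sitePercolation (Site 2) half).prod (sitePercolation (Site 2) half))))

/-- Colour of the cell `v`: `A_{v0} ⊕ B_{v1} ⊕` parity of the syndromes in the rectangle between `0` and `v`
(verbatim the crux's `blk`, with its `par` at `S = univ`). [folklore] -/
def gaugeColour : Bits → Site 2 → Prop :=
  let par : Bits → Site 2 → Prop := fun ω f =>
    (f 0 ∈ (Set.univ : Set ℤ) ∧ f ∈ ω.2.2.1) ∨ (f 0 ∉ (Set.univ : Set ℤ) ∧ f ∈ ω.2.2.2.1)
  fun ω v => Xor (v 0 ∈ ω.1) (Xor (v 1 ∈ ω.2.1)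
    (Odd ((Finset.filter (fun f : ℤ × ℤ => par ω ![f.1, f.2])
      (Finset.Ico (min 0 (v 0)) (max 0 (v 0)) ×ˢ Finset.Ico (min 0 (v 1)) (max 0 (v 1)))).card)))

/-- The saddle coin at the face `f` (anti-diagonal chosen); verbatim the crux's `anti` at `S = univ`. [folklore] -/
def gaugeCoin : Bits → Site 2 → Prop := fun ω f => f 0 ∉ (Set.univ : Set ℤ) ∨ f ∈ ω.2.2.2.2

/-- The black bond configuration of the cell graph: same-colour axis neighbours, plus the coin-chosen
diagonal of each face (verbatim the crux's `edges`). [folklore] -/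
def gaugeEdges (ω : Bits) : BondConfig (Site 2) :=
  {e | ∃ u v, e = s(u, v) ∧ gaugeColour ω u ∧ gaugeColour ω v ∧
    (v = u + ![1, 0] ∨ v = u + ![0, 1] ∨ (v = u + ![1, 1] ∧ ¬ gaugeCoin ω u) ∨
      (v = u + ![1, -1] ∧ gaugeCoin ω (u + ![0, -1])))}

/-- The crude embedded crossing event of the conformal rectangle `R` at mesh `δ` (cells at `v0 + i v1`,
G02/GM14 recipe `embDomainCrossing`, arcs `0 → 2`), as an event on the bit space. [folklore] -/
def crossingEvent (R : ConformalRectangle) (δ : ℝ) : Set Bits :=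
  {ω | gaugeEdges ω ∈ embDomainCrossing
    (fun v : Site 2 => ((v 0 : ℝ) : ℂ) + ((v 1 : ℝ) : ℂ) * Complex.I) R.carrier δ (R.arc 0) (R.arc 2)}

/-- Crude crossing probability of `R` at mesh `δ` for the corner-line model with syndrome density `p`.
`gaugeCrossingProb (2√3−3)` is the crux's `P_IK` (`cornerLineDescent_iff`, `Iff.rfl`). [folklore] -/
def gaugeCrossingProb (p : ℝ) (R : ConformalRectangle) (δ : ℝ) : ℝ :=
  (gaugeMeasure p).real (crossingEvent R δ)

/-- The standard-embedding bond-`ℤ²` crude crossing probability at `p = ½` (the crux's consequent family,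
verbatim). [folklore] -/
def bondStdCrossingProb (R : ConformalRectangle) (δ : ℝ) : ℝ :=
  (bondPercolation (zdGraph 2) half).real
    (embDomainCrossing squareLatticeEmbedding.z R.carrier δ (R.arc 0) (R.arc 2))

/-- The isotropic Izergin–Korepin syndrome density `p_IK = 2√3 − 3 ≈ 0.4641` (`t = p/(1−p) = √3/2`). [folklore] -/
def pIK : ℝ := 2 * Real.sqrt 3 - 3

/-- `0 < p_IK` (`√3 > 3/2`). [folklore] -/
theorem pIK_pos : 0 < pIK := by
  have h : (3 / 2 : ℝ) < Real.sqrt 3 := (Real.lt_sqrt (by norm_num)).2 (by norm_num)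
  unfold pIK; linarith

/-- `p_IK ≤ 1` (`√3 ≤ 2`). [folklore] -/
theorem pIK_le_one : pIK ≤ 1 := by
  have h3 : Real.sqrt 3 ^ 2 = 3 := Real.sq_sqrt (by norm_num)
  have h0 : 0 ≤ Real.sqrt 3 := Real.sqrt_nonneg 3
  unfold pIK; nlinarith

/-- SANITY (`Iff.rfl`): the crux BY NAME is literally "Cardy for `gaugeCrossingProb p_IK` in every conformal
rectangle ⇒ Cardy for `bondStdCrossingProb` in every conformal rectangle". [folklore] -/
theorem cornerLineDescent_iff :
    Summit.CriticalPhenomena.CardyFormulaZ2.Theses.CardyIKTransport.CornerLineDescent ↔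
      ((∀ R : ConformalRectangle, R.HasCrossingLimit (gaugeCrossingProb pIK R) cardyFunction) →
        ∀ R : ConformalRectangle, R.HasCrossingLimit (bondStdCrossingProb R) cardyFunction) :=
  Iff.rfl

/-! ## §2 Russo's seed: the forced syndrome and its signed influence -/

/-- Force the syndrome bit at the face `f` to the value `b`, leaving every other bit unchanged. [folklore] -/
def force (f : Site 2) (b : Bool) (ω : Bits) : Bits :=
  (ω.1, ω.2.1, (if b then insert f ω.2.2.1 else ω.2.2.1 \ {f}), ω.2.2.2)

/-- The SIGNED INFLUENCE of the syndrome at `f` on the crude crossing of `R` at mesh `δ`, density `p`: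
`I_f(p) = P_p[A | κ_f = 1] − P_p[A | κ_f = 0]` written through forced configurations (product measure:
forcing = conditioning).  By law-locality (`Negative.QuadrantFlipLocal`) `I_f = Cov_p(1_A, κ_f)/(p(1−p))`
for `0 < p < 1`, the covariance of the crossing with the LOCAL face parity under `M(t,½)`, `t = p/(1−p)`;
faces whose defect rectangle misses the lattice window of `R` have `I_f = 0` exactly. [folklore] -/
def influence (p : ℝ) (R : ConformalRectangle) (δ : ℝ) (f : Site 2) : ℝ :=
  (gaugeMeasure p).real (force f true ⁻¹' crossingEvent R δ) -
    (gaugeMeasure p).real (force f false ⁻¹' crossingEvent R δ)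

/-- The UNSIGNED Russo sum `Σ_f |I_f(p)|` over all faces (a `finsum`: only the finitely many faces in the
bounding box of the lattice window of `R` and the origin have non-zero influence; see `stub_Russo`). [folklore] -/
def influenceSum (p : ℝ) (R : ConformalRectangle) (δ : ℝ) : ℝ :=
  ∑ᶠ f : Site 2, |influence p R δ f|

/-! ## §3 The statements of the line (parametrised predicates; quantified in the stub signatures) -/

/-- The boundary RING of the `(2r+2) × (2r+2)` block of cells centred on the face `f` (the face `f` is the
grid vertex shared by the cells `f, f+e₀, f+e₁, f+e₀+e₁`; the block is `[f0−r, f0+1+r] × [f1−r, f1+1+r]`). [folklore] -/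
def faceRing (f : Site 2) (r : ℕ) : Set (Site 2) :=
  {v | (f 0 - r ≤ v 0 ∧ v 0 ≤ f 0 + 1 + r ∧ f 1 - r ≤ v 1 ∧ v 1 ≤ f 1 + 1 + r) ∧
    (v 0 = f 0 - r ∨ v 0 = f 0 + 1 + r ∨ v 1 = f 1 - r ∨ v 1 = f 1 + 1 + r)}

/-- The cylinder event "the colours on the ring `faceRing f r` are given by `η`". [folklore] -/
def ringCylinder (f : Site 2) (r : ℕ) (η : Site 2 → Prop) : Set Bits :=
  {ω | ∀ v ∈ faceRing f r, (gaugeColour ω v ↔ η v)}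

/-- `SyndromeBiasAt p C`: under the gauge with density `p`, for every radius `r ≥ 1`, every face `f` and
every ring colouring `η`, the conditional bias of the syndrome at `f` given the ring colours is at most
`C ρ^{2r}`, `ρ = |1 − 2p|` — stated multiplicatively (no division by the cylinder probability):
`|P[κ_f = 1, Cyl] − p·P[Cyl]| ≤ C ρ^{2r} P[Cyl]`.  WHY TRUE: the block marginal of the gauge is the free
corner-fugacity field (uniform antiderivative: `σ = a_x ⊕ b_y ⊕ Π_block`), the ring colours reveal exactly
`a ⊕ b` and the full-row / full-column parities of the `(2r+1)²` enclosed i.i.d. Bernoulli(`p`) syndromes,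
and by the character expansion over the row/column code (all non-zero codewords have weight `≥ 2r+1`; only
codewords through `f` contribute to the bias, the lightest being the row and the column of `f`)
`E[(−1)^{κ_f} | parities] − ρ = ±(1−ρ²)·2ρ^{2r}(1 + O_ρ(1))/D(s)` with `D(s) → 1`; exact enumeration
(triage r1-3, E1, 4×4 block = `r = 1`): max bias `5.9e-3` at `t = √3/2` (`ρ² = 5.2e-3`), `0` at `t = 1`.
By the Markov property of the plaquette weight across a width-one ring and the independence of the coins,
this is the conditional bias given EVERYTHING outside the core block — the `m_f` of the zero-amplitude
argument. [folklore] -/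
def SyndromeBiasAt (p C : ℝ) : Prop :=
  ∀ r : ℕ, 1 ≤ r → ∀ (f : Site 2) (η : Site 2 → Prop),
    |(gaugeMeasure p).real ({ω | f ∈ ω.2.2.1} ∩ ringCylinder f r η) -
        p * (gaugeMeasure p).real (ringCylinder f r η)| ≤
      C * |1 - 2 * p| ^ (2 * r) * (gaugeMeasure p).real (ringCylinder f r η)

/-- `InfluenceBoundOn R θ C c₀ δ`: at mesh `δ`, for every density `p` with `c₀ δ ≤ p ≤ p_IK` (box larger
than `c₀⁻¹` wall-persistence lengths `ξ_p ≍ 1/p`), the unsigned Russo sum is second order: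
`Σ_f |I_f(p)| ≤ C p⁻¹ (δ/p)^θ`, i.e. `Σ_f |Cov_p(1_A, κ_f)| ≤ C (1−p) (δ/p)^θ` — so
`|p ∂_p P_p(A)| ≤ C (δ/p)^θ = C (δ ξ_p)^θ`: the log-derivative along the corner line is small as soon as the
wall-persistence length `δ ξ_p` (macroscopic units) is small.  THE LOAD-BEARING CLAIM OF THE LINE (card U2;
`CoveringLatticeShiftNarrow`'s un-blocked residue (b), a RATE): per bulk face, a gain of `δ^{3/4+θ}` over
the four-arm price `π₄ ≈ δ^{5/4}` needs the zero four-arm amplitude of the symmetric seed (`ι`-oddness +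
`SyndromeBiasAt`) AND a memory rate `> 3/4 = 2 − α₄` in the `ι`-odd, `D₄`-trivial sector (bet: six-arm
minus four-arm, `35/12 − 5/4 > 3/4`); the boundary layer
(response exponent `1`, `δ⁻¹` faces; Disproof §G(4)) and exterior faces (those recolouring the window by a
half-plane: zero exactly, half-plane flips being gauge symmetries, cf. `Negative.isOddFace_halfFlip₀_iff`; those
whose two rays cut the window: exterior dislocations, parity correlations `ρ^{area}`) are INCLUDED in the sum
and must be budgeted separately by the prover. [folklore] -/
def InfluenceBoundOn (R : ConformalRectangle) (θ C c₀ δ : ℝ) : Prop :=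
  ∀ p : ℝ, c₀ * δ ≤ p → p ≤ pIK → influenceSum p R δ ≤ C * p⁻¹ * (δ / p) ^ θ

/-- `DiluteBoundOn R c C κ δ`: in the dilute regime `0 ≤ p ≤ c δ` (`O(c)` dislocations per grid line, wall
persistence `ξ_p ≥ (cδ)⁻¹` macroscopic) the unsigned Russo sum is `≤ C δ^{κ−1}`, i.e. the signed annealed
single-dislocation influence has size exponent `x₀ = 1 + κ > 1` uniformly over faces (`Σ_f` has `≍ δ⁻²`
terms).  WHY PLAUSIBLE: law-locality puts the natural size at the core four-arm price `x₀ = x₄ = 5/4`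
(Disproof §G(2)); the unsigned seam coupling only gives `x₀ = 1/4`, so the proof is the SIGNED lemma —
annealed Burgers neutrality (face types `∅, V, H, +` each of probability exactly `1/4`, `b_∅ = −b_+`,
`b_V = −b_H`, triage r1-2 S2) kills the `O(δ)` strain term, the frozen-end face of the `D₄` selection rule;
numerics: exact `4×2, 6×3` anchors `−0.0547, −0.0319` and paired MC `L = 8…128` give `|I_f| ≈ n^{−1.2}`,
same sign (triage r1-3 T1; kit j010398, j010196/j010258, j010369 pending).  This is the honest second hard
stub (triage r1-1 (3)): RegimeOne is NOT bond-`ℤ²` toolbox. [folklore] -/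
def DiluteBoundOn (R : ConformalRectangle) (c C κ δ : ℝ) : Prop :=
  ∀ p : ℝ, 0 ≤ p → p ≤ c * δ → influenceSum p R δ ≤ C * δ ^ (κ - 1)

/-- `RussoLipschitzOn R δ p₁ p₂ M`: the Margulis–Russo formula for the NON-MONOTONE product gauge in
mean-value form — if `Σ_f |I_f(p)| ≤ M` on `[p₁, p₂]` then `|P_{p₂}(A) − P_{p₁}(A)| ≤ M (p₂ − p₁)`.
WHY TRUE / WORK: the crude event depends on the bits of finitely many cells (the lattice window of the
bounded `R.carrier`), hence on finitely many syndromes (those in the bounding box of the window and the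
origin — every other face has `force f b ⁻¹' A = A`, so `I_f = 0` and the `finsum` is a finite sum), so
`p ↦ P_p(A)` is a polynomial on `[0,1]` with derivative `Σ_f I_f(p)` (`Set.projIcc` is the identity there);
then the mean value inequality.  Lean work: cylinder-set measurability and independence for
`sitePercolation = setBer(univ, p)`, product-measure Fubini. [folklore] -/
def RussoLipschitzOn (R : ConformalRectangle) (δ p₁ p₂ M : ℝ) : Prop :=
  (∀ p : ℝ, p₁ ≤ p → p ≤ p₂ → influenceSum p R δ ≤ M) →
    |gaugeCrossingProb p₂ R δ - gaugeCrossingProb p₁ R δ| ≤ M * (p₂ - p₁)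

/-- `CrossingEventLocalAt R δ`: the crude crossing event of `R` at mesh `δ` is DETERMINED BY FINITELY MANY BITS of
each of the five factors (column bits, row bits, syndromes, the unused field, coins): two bit configurations that
agree on the finite sets `K₁, …, K₅` are both in or both out of `crossingEvent R δ`.  WHY TRUE (for `δ > 0`): the
window `W = {v | δ·(v0 + i v1) ∈ R.carrier}` is finite (`R.carrier` is bounded), an open path of the event has all
its vertices in `W` (`embDomainCrossing = openCrossing W _ _`, `PlanarDuality.determinedBy_openCrossing`), an edge
`s(u,v)` with `u, v ∈ W` is in `gaugeEdges ω` iff a condition on the colours of `u, v` and the coins at `u`,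
`u + (0,-1)` holds, and `gaugeColour ω v` reads `ω.1` at `v0`, `ω.2.1` at `v1` and `ω.2.2.1` on the finite rectangle
`Ico (min 0 v0) (max 0 v0) × Ico (min 0 v1) (max 0 v1)` (the fourth factor is never read: `par` at `S = univ`).
The finite-support property of `influenceSum` (faces outside `K₃` have `force f b ⁻¹' A = A`, influence `0`) and the
measurability of the event (finite union of product cylinders) both follow. [folklore] -/
def CrossingEventLocalAt (R : ConformalRectangle) (δ : ℝ) : Prop :=
  ∃ (K₁ K₂ : Finset ℤ) (K₃ K₄ K₅ : Finset (Site 2)), ∀ ω ω' : Bits,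
    ω.1 ∩ ↑K₁ = ω'.1 ∩ ↑K₁ → ω.2.1 ∩ ↑K₂ = ω'.2.1 ∩ ↑K₂ → ω.2.2.1 ∩ ↑K₃ = ω'.2.2.1 ∩ ↑K₃ →
      ω.2.2.2.1 ∩ ↑K₄ = ω'.2.2.2.1 ∩ ↑K₄ → ω.2.2.2.2 ∩ ↑K₅ = ω'.2.2.2.2 ∩ ↑K₅ →
        (ω ∈ crossingEvent R δ ↔ ω' ∈ crossingEvent R δ)

/-! ## §3b Milestone M1 (typed, NOT a registered stub): the fixed-`t` bulk lattice form of U2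

Triage r1-1 (2) / r1-2 asked for U2 "in lattice form: `max_{bulk f} |Cov_t(1_LR(2n×n), κ_f)| ≤ C n^{−2−c}`
uniformly for `t` in compacts of `(0,1]`".  That statement does not feed the composition (the crossover
`t ≍ Kδ` needs the bound in units of `ξ_t`, and general conformal rectangles need the boundary layer), so it
is recorded here as the line's first MILESTONE and numerical proxy, over the tree's free corner-fugacity
measure (box marginal of the gauge, `t = p/(1−p)`): the lead may promote it to a registered stub of a
reshaped skeleton.  Exact transfer matrices (ideator, `TMLocalResultsIdeator1.md`; kit j008873): the Russo
sum `S(t;n) = Σ_f Cov_t(1_LR, κ_f)` on `2n × n` boxes DECREASES like `n^{−0.30…−0.36}` for `n = 4…7` at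
`t = √3/2, 1` — i.e. `θ ≈ 0.3` in `Σ_f ≍ n² · n^{−2−θ}`, against GROWTH `n^{3/4}` for a non-zero four-arm
amplitude. -/

/-- `BulkBoxMemoryAt t C θ n`: on the box of cells `rectangle (2n) n = [0,2n] × [0,n]` under the free
corner-fugacity measure `M(t,½)`, every BULK face `f` (middle half in each direction) has
`|Cov_t(1_{LR}, 1_{f odd})| ≤ C n^{−(2+θ)}`: memory rate `θ` beyond the face count, i.e. `3/4 + θ` beyond
the four-arm price.  MILESTONE CLAIM (not registered): `∀ t₀ > 0, ∃ C θ > 0, ∀ t ∈ [t₀,1], ∀ n ≥ 1,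
BulkBoxMemoryAt t C θ n`. [folklore] -/
def BulkBoxMemoryAt (t : ℝ≥0) (C θ : ℝ) (n : ℕ) : Prop :=
  ∀ f : Site 2, (n : ℤ) ≤ 2 * f 0 → 2 * f 0 ≤ 3 * n → (n : ℤ) ≤ 4 * f 1 → 4 * f 1 ≤ 3 * n →
    |(freeCornerFugacityMeasure t half (rectangle (2 * n) n)).real
          (cellLRCrossing (2 * n) n ∩ {ω | IsOddFace ω.1 f}) -
        (freeCornerFugacityMeasure t half (rectangle (2 * n) n)).real (cellLRCrossing (2 * n) n) *
          (freeCornerFugacityMeasure t half (rectangle (2 * n) n)).real {ω | IsOddFace ω.1 f}| ≤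
      C * (n : ℝ) ^ (-(2 + θ))

/-! ## §4 Proved plumbing: dyadic Russo integration, the dilute window, and the overlap (no `sorry`) -/

/-- Dyadic summation (elementary real analysis): one-octave increments bounded by the profile
`A (δ/a)^θ` telescope to `A (δ/p)^θ / (1 − 2^{−θ})`. [folklore] -/
theorem dyadic_sum_bound (G : ℝ → ℝ) (p q A θ δ : ℝ) (hp : 0 < p) (hθ : 0 < θ) (hA : 0 ≤ A)
    (hδ : 0 ≤ δ) (hpq : p ≤ q)
    (hstep : ∀ a b : ℝ, p ≤ a → a ≤ b → b ≤ q → b ≤ 2 * a → |G b - G a| ≤ A * (δ / a) ^ θ) :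
    |G q - G p| ≤ A / (1 - (1 / 2 : ℝ) ^ θ) * (δ / p) ^ θ := by
  set r : ℝ := (1 / 2 : ℝ) ^ θ with hr
  have hr0 : 0 ≤ r := Real.rpow_nonneg (by norm_num) θ
  have hr1 : r < 1 := Real.rpow_lt_one (by norm_num) (by norm_num) hθ
  have hδp : 0 ≤ δ / p := div_nonneg hδ hp.le
  -- the `k`-th octave profile
  have hoct : ∀ k : ℕ, (δ / (2 ^ k * p)) ^ θ = (δ / p) ^ θ * r ^ k := by
    intro k
    rw [hr, Real.rpow_pow_comm (by norm_num) θ k, ← Real.mul_rpow hδp (by positivity)]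
    congr 1
    rw [one_div_pow]
    field_simp
  -- telescoping along the dyadic points `2^k p`
  have aux : ∀ N : ℕ, ∀ q', p ≤ q' → q' ≤ q → q' ≤ 2 ^ N * p →
      |G q' - G p| ≤ A * (δ / p) ^ θ * ∑ k ∈ Finset.range N, r ^ k := by
    intro N
    induction N with
    | zero =>
      intro q' h1 _ h3
      have h3' : q' ≤ p := by simpa using h3
      have : q' = p := le_antisymm h3' h1
      simp [this]
    | succ N ih =>
      intro q' h1 h2 h3
      by_cases hc : q' ≤ 2 ^ N * p
      · refine (ih q' h1 h2 hc).trans ?_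
        apply mul_le_mul_of_nonneg_left _ (by positivity)
        apply Finset.sum_le_sum_of_subset_of_nonneg (Finset.range_mono (Nat.le_succ N))
        intro i _ _
        positivity
      · have hc : 2 ^ N * p < q' := lt_of_not_ge hc
        have h2N : (1:ℝ) ≤ 2 ^ N := one_le_pow₀ (by norm_num)
        have hpa : p ≤ 2 ^ N * p := le_mul_of_one_le_left hp.le h2N
        have haq : 2 ^ N * p ≤ q' := hc.le
        have hb2 : q' ≤ 2 * (2 ^ N * p) := by
          have : (2:ℝ) ^ (N + 1) * p = 2 * (2 ^ N * p) := by ring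
          rw [this] at h3; exact h3
        have step := hstep (2 ^ N * p) q' hpa haq h2 hb2
        have prev := ih (2 ^ N * p) hpa (haq.trans h2) le_rfl
        calc |G q' - G p| ≤ |G q' - G (2 ^ N * p)| + |G (2 ^ N * p) - G p| := abs_sub_le _ _ _
          _ ≤ A * (δ / (2 ^ N * p)) ^ θ + A * (δ / p) ^ θ * ∑ k ∈ Finset.range N, r ^ k :=
              add_le_add step prev
          _ = A * (δ / p) ^ θ * ∑ k ∈ Finset.range (N + 1), r ^ k := by
              rw [Finset.sum_range_succ, hoct N]; ring
  -- enough octaves to reach `q`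
  obtain ⟨N, hN⟩ : ∃ N : ℕ, q ≤ 2 ^ N * p := by
    obtain ⟨N, hN⟩ := pow_unbounded_of_one_lt (q / p) (by norm_num : (1:ℝ) < 2)
    exact ⟨N, by rw [div_lt_iff₀ hp] at hN; exact hN.le⟩
  have hgeom : ∑ k ∈ Finset.range N, r ^ k ≤ (1 - r)⁻¹ :=
    sum_le_hasSum (Finset.range N) (fun i _ => pow_nonneg hr0 i) (hasSum_geometric_of_lt_one hr0 hr1)
  calc |G q - G p| ≤ A * (δ / p) ^ θ * ∑ k ∈ Finset.range N, r ^ k := aux N q hpq le_rfl hN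
    _ ≤ A * (δ / p) ^ θ * (1 - r)⁻¹ := by
        apply mul_le_mul_of_nonneg_left hgeom (by positivity)
    _ = A / (1 - r) * (δ / p) ^ θ := by rw [div_eq_mul_inv]; ring

/-- UNIFORM CORNER IRRELEVANCE in units of `ξ_p` (the card's `UniformCornerIrrelevance`, here DERIVED):
Russo in mean-value form + the summed influence bound, integrated dyadically in `p`, give
`|P_{p_IK}(R,δ) − P_p(R,δ)| ≤ C' (δ/p)^θ` for `c₀ δ ≤ p ≤ p_IK`, eventually in `δ`. [folklore] -/
theorem uci_of
    (hrusso : ∀ (R : ConformalRectangle) (δ : ℝ), 0 < δ → ∀ p₁ p₂ M : ℝ, 0 ≤ p₁ → p₁ ≤ p₂ → p₂ ≤ 1 →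
      RussoLipschitzOn R δ p₁ p₂ M)
    (hsum : ∀ R : ConformalRectangle, ∃ θ C c₀ : ℝ, 0 < θ ∧ 0 < c₀ ∧
      ∀ᶠ δ in 𝓝[>] (0:ℝ), InfluenceBoundOn R θ C c₀ δ)
    (R : ConformalRectangle) :
    ∃ θ C c₀ : ℝ, 0 < θ ∧ 0 < c₀ ∧ ∀ᶠ δ in 𝓝[>] (0:ℝ), ∀ p : ℝ, c₀ * δ ≤ p → p ≤ pIK →
      |gaugeCrossingProb pIK R δ - gaugeCrossingProb p R δ| ≤ C * (δ / p) ^ θ := by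
  obtain ⟨θ, C, c₀, hθ, hc₀, hev⟩ := hsum R
  set C' : ℝ := max C 0 with hC'
  have hC'0 : 0 ≤ C' := le_max_right _ _
  refine ⟨θ, C' / (1 - (1 / 2 : ℝ) ^ θ), c₀, hθ, hc₀, ?_⟩
  have hpos : ∀ᶠ δ in 𝓝[>] (0:ℝ), δ ∈ Set.Ioi (0:ℝ) := eventually_mem_nhdsWithin
  filter_upwards [hev, hpos] with δ hδB hδ
  have hδ : 0 < δ := hδ
  intro p hp1 hp2
  have hp : 0 < p := lt_of_lt_of_le (mul_pos hc₀ hδ) hp1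
  -- one octave: Russo with the monotone majorant `C' a⁻¹ (δ/a)^θ`
  have hstep : ∀ a b : ℝ, p ≤ a → a ≤ b → b ≤ pIK → b ≤ 2 * a →
      |gaugeCrossingProb b R δ - gaugeCrossingProb a R δ| ≤ C' * (δ / a) ^ θ := by
    intro a b hpa hab hbq hb2
    have ha : 0 < a := hp.trans_le hpa
    set M : ℝ := C' * a⁻¹ * (δ / a) ^ θ with hM
    have hMnn : 0 ≤ M := by positivity
    have hbound : ∀ s : ℝ, a ≤ s → s ≤ b → influenceSum s R δ ≤ M := by
      intro s has hsb
      have hs : 0 < s := ha.trans_le has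
      have h0 := hδB s (hp1.trans (hpa.trans has)) (hsb.trans hbq)
      have hX1 : s⁻¹ ≤ a⁻¹ := inv_anti₀ ha has
      have hX2 : (δ / s) ^ θ ≤ (δ / a) ^ θ :=
        Real.rpow_le_rpow (by positivity) (div_le_div_of_nonneg_left hδ.le ha has) hθ.le
      calc influenceSum s R δ ≤ C * s⁻¹ * (δ / s) ^ θ := h0
        _ ≤ C' * s⁻¹ * (δ / s) ^ θ := by
            apply mul_le_mul_of_nonneg_right _ (by positivity)
            exact mul_le_mul_of_nonneg_right (le_max_left _ _) (by positivity)
        _ ≤ C' * a⁻¹ * (δ / a) ^ θ := by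
            apply mul_le_mul (mul_le_mul_of_nonneg_left hX1 hC'0) hX2 (by positivity) (by positivity)
    have hr := hrusso R δ hδ a b M ha.le hab (hbq.trans pIK_le_one) hbound
    calc |gaugeCrossingProb b R δ - gaugeCrossingProb a R δ| ≤ M * (b - a) := hr
      _ ≤ M * a := by apply mul_le_mul_of_nonneg_left _ hMnn; linarith
      _ = C' * (δ / a) ^ θ := by rw [hM]; field_simp
  have key := dyadic_sum_bound (fun s => gaugeCrossingProb s R δ) p pIK C' θ δ hp hθ hC'0 hδ.le hp2 hstep
  simpa using key

/-- REGIME ONE (the card's `RegimeOne`, here DERIVED): Russo in mean-value form + the dilute influence bound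
give, for every window constant `c`, `|P_p(R,δ) − P_0(R,δ)| ≤ ε` for all `p ≤ c δ`, eventually in `δ`. [folklore] -/
theorem regimeOne_of
    (hrusso : ∀ (R : ConformalRectangle) (δ : ℝ), 0 < δ → ∀ p₁ p₂ M : ℝ, 0 ≤ p₁ → p₁ ≤ p₂ → p₂ ≤ 1 →
      RussoLipschitzOn R δ p₁ p₂ M)
    (hdil : ∀ (R : ConformalRectangle) (c : ℝ), 0 < c → ∃ C κ : ℝ, 0 < κ ∧
      ∀ᶠ δ in 𝓝[>] (0:ℝ), DiluteBoundOn R c C κ δ)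
    (R : ConformalRectangle) (ε : ℝ) (hε : 0 < ε) (c : ℝ) (hc : 0 < c) :
    ∀ᶠ δ in 𝓝[>] (0:ℝ), ∀ p : ℝ, 0 ≤ p → p ≤ c * δ →
      |gaugeCrossingProb p R δ - gaugeCrossingProb 0 R δ| ≤ ε := by
  obtain ⟨C, κ, hκ, hev⟩ := hdil R c hc
  set C' : ℝ := max C 0 with hC'
  have hC'0 : 0 ≤ C' := le_max_right _ _
  have h1 : ∀ᶠ δ in 𝓝[>] (0:ℝ), C' * c * δ ^ κ ≤ ε := by
    have h0 : Tendsto (fun δ : ℝ => δ ^ κ) (𝓝[>] (0:ℝ)) (𝓝 0) := by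
      have hcont := (Real.continuousAt_rpow_const 0 κ (Or.inr hκ.le)).tendsto
      rw [Real.zero_rpow hκ.ne'] at hcont
      exact hcont.mono_left nhdsWithin_le_nhds
    have ht : Tendsto (fun δ : ℝ => C' * c * δ ^ κ) (𝓝[>] (0:ℝ)) (𝓝 0) := by
      simpa using h0.const_mul (C' * c)
    exact ht.eventually_le_const hε
  have h2 : ∀ᶠ δ in 𝓝[>] (0:ℝ), c * δ ≤ 1 := by
    have ht : Tendsto (fun δ : ℝ => c * δ) (𝓝[>] (0:ℝ)) (𝓝 0) := by
      have h0 : Tendsto (fun δ : ℝ => c * δ) (𝓝 (0:ℝ)) (𝓝 (c * 0)) :=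
        tendsto_const_nhds.mul tendsto_id
      rw [mul_zero] at h0
      exact h0.mono_left nhdsWithin_le_nhds
    exact ht.eventually_le_const one_pos
  have h3 : ∀ᶠ δ in 𝓝[>] (0:ℝ), δ ∈ Set.Ioi (0:ℝ) := eventually_mem_nhdsWithin
  filter_upwards [hev, h1, h2, h3] with δ hD hε' hcδ hδ
  have hδ : 0 < δ := hδ
  intro p hp0 hpc
  have hM : ∀ s : ℝ, 0 ≤ s → s ≤ p → influenceSum s R δ ≤ C' * δ ^ (κ - 1) := fun s hs0 hsp =>
    (hD s hs0 (hsp.trans hpc)).trans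
      (mul_le_mul_of_nonneg_right (le_max_left _ _) (Real.rpow_nonneg hδ.le _))
  have hr := hrusso R δ hδ 0 p (C' * δ ^ (κ - 1)) le_rfl hp0 (hpc.trans hcδ) hM
  rw [sub_zero] at hr
  have hpow : δ ^ κ = δ ^ (κ - 1) * δ := by
    rw [Real.rpow_sub_one hδ.ne', div_mul_cancel₀ _ hδ.ne']
  calc |gaugeCrossingProb p R δ - gaugeCrossingProb 0 R δ| ≤ C' * δ ^ (κ - 1) * p := hr
    _ ≤ C' * δ ^ (κ - 1) * (c * δ) := by
        apply mul_le_mul_of_nonneg_left hpc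
        exact mul_nonneg hC'0 (Real.rpow_nonneg hδ.le _)
    _ = C' * c * δ ^ κ := by rw [hpow]; ring
    _ ≤ ε := hε'

/-- THE OVERLAP (the card's `endgame_core`, logic only): Regime One and uniform corner irrelevance in units of
`ξ_p` meet at `p = K δ` — take `K ≥ c₀` with `C K^{−θ} ≤ ε/2` — so the isotropic-IK gauge model and the
renewal-grid bond model `p = 0` have the same crude crossing probabilities up to `o(1)`, for every conformal
rectangle: NO limit object, no `t → 0⁺` interchange of limits. [folklore] -/
theorem endgame_core
    (h1 : ∀ (R : ConformalRectangle) (ε : ℝ), 0 < ε → ∀ c : ℝ, 0 < c →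
      ∀ᶠ δ in 𝓝[>] (0:ℝ), ∀ p : ℝ, 0 ≤ p → p ≤ c * δ →
        |gaugeCrossingProb p R δ - gaugeCrossingProb 0 R δ| ≤ ε)
    (h2 : ∀ R : ConformalRectangle, ∃ θ C c₀ : ℝ, 0 < θ ∧ 0 < c₀ ∧
      ∀ᶠ δ in 𝓝[>] (0:ℝ), ∀ p : ℝ, c₀ * δ ≤ p → p ≤ pIK →
        |gaugeCrossingProb pIK R δ - gaugeCrossingProb p R δ| ≤ C * (δ / p) ^ θ)
    (R : ConformalRectangle) (ε : ℝ) (hε : 0 < ε) :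
    ∀ᶠ δ in 𝓝[>] (0:ℝ), |gaugeCrossingProb pIK R δ - gaugeCrossingProb 0 R δ| ≤ ε := by
  obtain ⟨θ, C, c₀, hθ, hc₀, hev2⟩ := h2 R
  -- window constant `K ≥ c₀` with `C (1/K)^θ ≤ ε/2`
  set M : ℝ := max (2 * C / ε) 1 with hM
  have hM1 : 1 ≤ M := le_max_right _ _
  have hMpos : 0 < M := lt_of_lt_of_le one_pos hM1
  set K₁ : ℝ := M ^ (1 / θ) with hK₁
  have hK₁pos : 0 < K₁ := Real.rpow_pos_of_pos hMpos _
  set K : ℝ := max c₀ K₁ with hK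
  have hKpos : 0 < K := lt_of_lt_of_le hc₀ (le_max_left _ _)
  have hK₁le : K₁ ≤ K := le_max_right _ _
  have hc₀le : c₀ ≤ K := le_max_left _ _
  have hKθ : (1 / K) ^ θ ≤ 1 / M := by
    have h1' : (1 / K) ^ θ ≤ (1 / K₁) ^ θ := by
      apply Real.rpow_le_rpow (by positivity)
      · exact one_div_le_one_div_of_le hK₁pos hK₁le
      · exact hθ.le
    have h2' : (1 / K₁) ^ θ = 1 / M := by
      rw [Real.div_rpow zero_le_one hK₁pos.le, Real.one_rpow, hK₁, ← Real.rpow_mul hMpos.le,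
        one_div_mul_cancel hθ.ne', Real.rpow_one]
    exact h1'.trans h2'.le
  have hCK : C * (1 / K) ^ θ ≤ ε / 2 := by
    by_cases hC : C ≤ 0
    · have h0 : 0 ≤ (1 / K) ^ θ := by positivity
      have : C * (1 / K) ^ θ ≤ 0 := mul_nonpos_of_nonpos_of_nonneg hC h0
      linarith
    · have hC : 0 < C := lt_of_not_ge hC
      have hM2 : 2 * C / ε ≤ M := le_max_left _ _
      calc C * (1 / K) ^ θ ≤ C * (1 / M) := by gcongr
        _ = C / M := by ring
        _ ≤ C / (2 * C / ε) := by
            apply div_le_div_of_nonneg_left hC.le (by positivity) hM2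
        _ = ε / 2 := by field_simp
  have hev1 := h1 R (ε / 2) (by positivity) K hKpos
  have hsmall : ∀ᶠ δ in 𝓝[>] (0:ℝ), δ ≤ pIK / K := by
    have : Set.Iio (pIK / K) ∈ 𝓝 (0 : ℝ) := by
      apply Iio_mem_nhds; exact div_pos pIK_pos hKpos
    filter_upwards [nhdsWithin_le_nhds this] with δ hδ using (Set.mem_Iio.1 hδ).le
  have hpos : ∀ᶠ δ in 𝓝[>] (0:ℝ), δ ∈ Set.Ioi (0:ℝ) := eventually_mem_nhdsWithin
  filter_upwards [hev1, hev2, hsmall, hpos] with δ h1δ h2δ h3δ h4δ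
  have h4δ : 0 < δ := h4δ
  set p : ℝ := K * δ with hp
  have hppos : 0 < p := mul_pos hKpos h4δ
  have hA := h1δ p hppos.le le_rfl
  have hplo : c₀ * δ ≤ p := by rw [hp]; exact mul_le_mul_of_nonneg_right hc₀le h4δ.le
  have hphi : p ≤ pIK := by
    rw [hp]; rw [le_div_iff₀ hKpos] at h3δ; linarith
  have hB := h2δ p hplo hphi
  have hδp : δ / p = 1 / K := by
    rw [hp]; field_simp
  rw [hδp] at hB
  have hB' : |gaugeCrossingProb pIK R δ - gaugeCrossingProb p R δ| ≤ ε / 2 := hB.trans hCK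
  calc |gaugeCrossingProb pIK R δ - gaugeCrossingProb 0 R δ|
      ≤ |gaugeCrossingProb pIK R δ - gaugeCrossingProb p R δ| +
          |gaugeCrossingProb p R δ - gaugeCrossingProb 0 R δ| := abs_sub_le _ _ _
    _ ≤ ε / 2 + ε / 2 := add_le_add hB' hA
    _ = ε := by ring

/-! ## §5 The composition (kernel-checked, no `sorry`) -/

/-- Local alias of the crux decl, used only as the conclusion of the sorry-free composition
`CornerLineDescent_of_stubs`, so that the skeleton theorem `CornerLineDescent_of` is the only theorem of this
file concluding the crux BY NAME (D-0027 §2.1 / A12 audit). [folklore] -/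
abbrev CruxStatement : Prop :=
  Summit.CriticalPhenomena.CardyFormulaZ2.Theses.CardyIKTransport.CornerLineDescent

/-- THE COMPOSITION: the five registered stub signatures imply the crux.  Russo + the two influence
bounds give Regime One and uniform corner irrelevance (`regimeOne_of`, `uci_of`), which overlap
(`endgame_core`): `P_IK(R,δ) − P_0(R,δ) → 0`.  THE HYPOTHESIS OF THE CRUX IS USED HERE: Cardy for `P_IK`
(`= gaugeCrossingProb p_IK`, by `Iff.rfl`) transfers along the vanishing difference to the renewal-grid
bond model `p = 0`, and `FreezeToStandard` carries it to the standard embedding. [folklore] -/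
theorem CornerLineDescent_of_stubs :
    (∀ p : ℝ, 0 < p → p < 1 → ∃ C : ℝ, SyndromeBiasAt p C) →
    ((∀ p : ℝ, 0 < p → p < 1 → ∃ C : ℝ, SyndromeBiasAt p C) →
      ∀ R : ConformalRectangle, ∃ θ C c₀ : ℝ, 0 < θ ∧ 0 < c₀ ∧
        ∀ᶠ δ in 𝓝[>] (0:ℝ), InfluenceBoundOn R θ C c₀ δ) →
    (∀ (R : ConformalRectangle) (c : ℝ), 0 < c → ∃ C κ : ℝ, 0 < κ ∧
      ∀ᶠ δ in 𝓝[>] (0:ℝ), DiluteBoundOn R c C κ δ) →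
    (∀ (R : ConformalRectangle) (δ : ℝ), 0 < δ → ∀ p₁ p₂ M : ℝ, 0 ≤ p₁ → p₁ ≤ p₂ → p₂ ≤ 1 →
      RussoLipschitzOn R δ p₁ p₂ M) →
    ((∀ R : ConformalRectangle, R.HasCrossingLimit (gaugeCrossingProb 0 R) cardyFunction) →
      ∀ R : ConformalRectangle, R.HasCrossingLimit (bondStdCrossingProb R) cardyFunction) →
    CruxStatement := by
  intro hbias hsum hdil hrusso hfreeze
  show Summit.CriticalPhenomena.CardyFormulaZ2.Theses.CardyIKTransport.CornerLineDescent
  rw [cornerLineDescent_iff]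
  intro hIK
  apply hfreeze
  intro R φ x hφx
  have hUCI := uci_of hrusso (hsum hbias)
  have hR1 := regimeOne_of hrusso hdil
  have h1 : Tendsto (gaugeCrossingProb pIK R) (𝓝[>] 0) (𝓝 (cardyFunction (crossRatio x))) :=
    hIK R φ x hφx
  have h2 : Tendsto (fun δ => gaugeCrossingProb pIK R δ - gaugeCrossingProb 0 R δ) (𝓝[>] 0) (𝓝 0) := by
    rw [Metric.tendsto_nhds]
    intro ε hε
    filter_upwards [endgame_core hR1 hUCI R (ε / 2) (half_pos hε)] with δ hδ
    rw [Real.dist_eq, sub_zero]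
    exact lt_of_le_of_lt hδ (half_lt_self hε)
  have h3 := h1.sub h2
  simp only [sub_sub_cancel, sub_zero] at h3
  exact h3

/-! ## §6 Registered stubs (the only `sorry`s of the line) -/

/-- STUB 1 · `stub_SyndromeBias` — the informative lattice input of the zero-amplitude selection rule
(replaces the ideator's content-free centred-square lemma, triage r1-3 sharpening): conditional bias of a
syndrome given the colours on a ring of radius `r` is `O_p(ρ^{2r})`.  Provable now; size M–L (finite
GF(2) character sums / the row–column parity code under a product measure). [folklore] -/
theorem stub_SyndromeBias : ∀ p : ℝ, 0 < p → p < 1 → ∃ C : ℝ, SyndromeBiasAt p C := by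
  sorry

/-- STUB 2 · `stub_SummedInfluence` — THE HARDEST, LOAD-BEARING STUB (card U2, in summed lattice form, in
units of `ξ_p`): given the exponentially small conditional bias of the seed, the unsigned Russo sum of the
corner seed over all faces is second order, `Σ_f |I_f(p)| ≤ C p⁻¹ (δ/p)^θ` for `c₀ δ ≤ p ≤ p_IK`.  Open even
for site-`𝕋`; the bet is the messenger/second-order memory bound for `D₄`-symmetric zero-amplitude seeds
(six-arm minus four-arm rate) in the bulk, the signed boundary-layer budget of Disproof §G(4), and quenched
RSW in the coins at scales `≥ ξ_p` (the line's U1, shared with r4 `IKMixedBoxCrossing`).  Size XL. [folklore] -/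
theorem stub_SummedInfluence :
    (∀ p : ℝ, 0 < p → p < 1 → ∃ C : ℝ, SyndromeBiasAt p C) →
      ∀ R : ConformalRectangle, ∃ θ C c₀ : ℝ, 0 < θ ∧ 0 < c₀ ∧
        ∀ᶠ δ in 𝓝[>] (0:ℝ), InfluenceBoundOn R θ C c₀ δ := by
  sorry

/-- STUB 3 · `stub_DiluteInfluence` — the frozen end (signed single-dislocation lemma, `x₀ > 1`): in the
dilute window `p ≤ c δ` the unsigned Russo sum is `≤ C δ^{κ−1}`.  Open; size L (annealed Burgers neutrality
+ law-locality + RSW/arm separation on renewal grids carrying `O(c)` dislocations per line). [folklore] -/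
theorem stub_DiluteInfluence :
    ∀ (R : ConformalRectangle) (c : ℝ), 0 < c → ∃ C κ : ℝ, 0 < κ ∧
      ∀ᶠ δ in 𝓝[>] (0:ℝ), DiluteBoundOn R c C κ δ := by
  sorry

/-- STUB 4a · `stub_Locality` (lead reshape, cycle 1) — at every mesh `δ > 0` the crude crossing event of `R` is
determined by finitely many bits of each factor (`CrossingEventLocalAt`).  Provable now; size M (window finiteness
from `JordanDomain` boundedness, `PlanarDuality.determinedBy_openCrossing`, unfolding `gaugeEdges`/`gaugeColour`). [folklore] -/
theorem stub_Locality :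
    ∀ (R : ConformalRectangle) (δ : ℝ), 0 < δ → CrossingEventLocalAt R δ := by
  sorry

/-- STUB 4b · `stub_Russo` — the Margulis–Russo formula for the non-monotone product gauge, mean-value form, FROM
locality: given `CrossingEventLocalAt` at every `δ > 0`, the event is a finite disjoint union of product cylinders,
`p ↦ P_p(A)` is a polynomial on `[0,1]` (only the syndrome factor carries `p`; `Set.projIcc` is the identity there)
whose derivative is `Σ_f I_f(p)` (pairing `S ↔ S ∪ {f}` as in `Russo.sum_dweight_eq_measureReal_pivotal`, without
monotonicity: the bracket is `1[S ∪ {f} ∈ A] − 1[S ∈ A]`, i.e. forcing = conditioning), the `finsum` is a finite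
sum (faces outside `K₃` have influence `0`), and the mean value inequality closes.  Provable now; size M–L (tree:
`Russo.cylPoly`, `Russo.hasDerivAt_cylPoly`, `Russo.measureReal_eq_cylPoly`, `Russo.setBernoulli_real_localCylinder`,
`DeterminedBy.eq_biUnion_localCylinder`, `measurableSet_localCylinder`, Mathlib `Measure.prod_prod`). [folklore] -/
theorem stub_Russo :
    (∀ (R : ConformalRectangle) (δ : ℝ), 0 < δ → CrossingEventLocalAt R δ) →
      ∀ (R : ConformalRectangle) (δ : ℝ), 0 < δ → ∀ p₁ p₂ M : ℝ, 0 ≤ p₁ → p₁ ≤ p₂ → p₂ ≤ 1 →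
        RussoLipschitzOn R δ p₁ p₂ M := by
  sorry

/-- STUB 5 · `stub_FreezeToStandard` — the `t = 0` end, in-law form of the route's support item
`RenewalGridHarmless` (stmt-4967) composed with the exact FreezeIdentification: BOTH SIDES ARE BOND-`ℤ²` AT
`½` (no IK, no `t > 0`: not the crux).  `gaugeCrossingProb 0` is, pathwise, fair bond percolation (the coins)
on the black blocks of the plaid `A_{v0} ⊕ B_{v1}` — a square lattice turned by `45°` and drawn on the renewal
product grid with i.i.d. Geometric(½) spacings of mean `2` — so the intended proof is the `o(1)` comparison
`gaugeCrossingProb 0 R δ − bondStdCrossingProb (e^{−iπ/4}·R) (2δ) → 0` (expected normalisation; SLLN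
homogenisation of the grid in probability, equicontinuity of crude crossing probabilities in the domain by
bond-`ℤ²` RSW near the accessible arcs — tree `BoxCrossingBounds` / `BoxCrossingJordan` /
`discreteCrossingProb_clusterPt_mem_Ioo_holds` —, block-vs-cell and `2δ`-slack bookkeeping near the marked
points), then rotation covariance of `HasCrossingLimit` over all `R` and the mesh reparametrisation
`δ ↦ 2δ`.  Provable with tree tools; size M–L (Lean-heavy). [folklore] -/
theorem stub_FreezeToStandard :
    (∀ R : ConformalRectangle, R.HasCrossingLimit (gaugeCrossingProb 0 R) cardyFunction) →
      ∀ R : ConformalRectangle, R.HasCrossingLimit (bondStdCrossingProb R) cardyFunction := by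
  sorry

/-- THE SKELETON THEOREM (D-0027 §3.3 / A12): concludes the crux `CornerLineDescent` BY NAME, modulo
exactly the six registered stubs `stub_*` (the only `sorry`s of this file; lead reshape: `stub_Russo stub_Locality`). [folklore] -/
theorem CornerLineDescent_of :
    Summit.CriticalPhenomena.CardyFormulaZ2.Theses.CardyIKTransport.CornerLineDescent :=
  CornerLineDescent_of_stubs stub_SyndromeBias stub_SummedInfluence stub_DiluteInfluence
    (stub_Russo stub_Locality) stub_FreezeToStandard

end Summit.CriticalPhenomena.CardyFormulaZ2.Cruxes.CornerLineDescent.SymmetricSeedSecondOrder
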